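import Summits.CriticalPhenomena.PercolationContinuityZ3.Theorems.PercNearOneGluingNoHeavyLowerTailSahiCombFiveUpSetRank
import Summits.CriticalPhenomena.PercolationContinuityZ3.Theorems.PercNearOneGluingNoHeavyLowerTailSahiCombFiveUpSetHybrid

/-!
# The five-up-set inequality, RANK route II: THE FIVE-UP-SET INEQUALITY IS A THEOREM (`fiveUpSetIneq_holds : FiveUpSetIneq`)

Support file of the one-cut programme (crux `NoHeavyLowerTail`, stmt-CriticalPhenomena-4575; lemma factory `prim-lf-1`, gen 16–18;
memo `FROM-prim-lf-1-gen17-FIVE-UPSET-PROOF.md`; the conjecture and its role: cell `prim-masterthm` seat P5, report `P5-LORENTZIAN-TEST.md`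
§11–12, tree file `…SahiCombFiveUpSet`).  We prove the gen-6 conjecture `FiveUpSet.FiveUpSetIneq`: for up-sets `P, A₀ ⊆ A₁, B₀ ⊆ B₁`
of a finite cube, `#(P ∩ A₁ ∩ refl B₀) + #(P ∩ refl A₀ ∩ B₁) + #(P ∩ refl (A₁ \ A₀) ∩ refl (B₁ \ B₀)) ≤ #(P ∩ A₁ ∩ B₁) + #(P ∩ A₀ ∩ B₀)`,
through its RANK STRENGTHENING (RANK-Z): the `{0,1}` matrix `Z[(d,ℓ),(t,ℓ')] = [d ⊆ t][ℓ ≤ ℓ']` between the DEMANDS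
`(P ∩ A₁ ∩ refl B₀) × {1} ⊔ (P ∩ (refl A₀ ∩ B₁ ⊔ refl(A₁\A₀) ∩ refl(B₁\B₀))) × {0}` and the SUPPLIES `(P ∩ A₁ ∩ B₁) × {1} ⊔ (P ∩ A₀ ∩ B₀) × {0}`
has full row rank over `ℚ`, so there are at most as many demands as supplies.

* **`rankZ_kernel_eq_zero`** — (RANK-Z) at `P = ⊤` in function language: if `a` is supported on `S₁ = A₁ ∩ refl B₀`, `b` on
  `S₂ ∪ S₃ = (refl A₀ ∩ B₁) ∪ refl((A₁\A₀) ∩ (B₁\B₀))`, `Σ_d (a_d + b_d)[d ⊆ t] = 0` on `A₁ ∩ B₁` and `Σ_d b_d [d ⊆ t] = 0` on `A₀ ∩ B₀`, then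
  `a = b = 0`.  PROOF (memo §3): expand every zeta function on `U₁ = A₁ ∩ B₁` in the antipodal basis (support lemma of `…FiveUpSetRank`):
  the `S₁`-part has coordinates supported on `refl(U₁ ∩ B₀)`, the `S₂`-part on `refl(U₁ ∩ A₀)`, the `S₃`-part is its own coordinate vector;
  independence (C1 on `U₁`) kills `b` on `S₃` and confines the `S₁`-coordinates to `refl(A₀ ∩ B₀)`; C1 on `A₀ ∩ B₀` (using the second
  equation) kills them; C1 on `B₀` then gives `a = 0`, and C1 on `A₀` gives `b = 0` on `S₂`.
* **`rankZ_kernel_eq_zero_of_upperSet`** — the same for a general up-set `P` (supports inside `P`, equations only on `P`): the restriction to `P`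
  is free, because a demand `d ∈ P` only sees `t ⊇ d`, which lie in `P` (memo §1).
* **`fiveUpSetIneq_holds : FiveUpSetIneq`** — the demand vectors are linearly independent in `ℚ^{supplies}` (`Fintype.linearIndependent_iff` +
  the kernel theorem), hence `#demands ≤ dim = #supplies` (`LinearIndependent.fintype_card_le_finrank`).
* Corollaries: **`threeUpSetIneq_holds : ThreeUpSetIneq`**, **`hybridKleitmanIneq_holds : HybridKleitmanIneq`** (the open face `B₀ = ∅` and its
  hybrid-Kleitman form, `…SahiCombFiveUpSetHybrid`); the unconditional thin-edge `TRI_W ≥ 0` on cubes is in `…SahiCombFiveUpSetTriWCube`.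
What stays open: the lattice form `LatticeFiveUpSet.FiveUpSetIneqLattice` on non-Boolean distributive lattices (the rank phenomenon is cube-specific,
report §12.1(b)).
HONEST LABEL: complete proofs, std axioms; no Hall, no SAT, no census input. [this work]
-/

namespace Summit.CriticalPhenomena.PercolationContinuityZ3.Theorems

namespace FiveUpSet

open Finset

variable {α : Type*} [DecidableEq α] [Fintype α]

/-! ### (RANK-Z) at `P = ⊤`: the kernel is trivial -/

/-- **(RANK-Z), kernel form at `P = ⊤`.**  Let `A₀ ⊆ A₁`, `B₀ ⊆ B₁` be up-sets of the cube `Finset α`, `a` a coefficient vector supported on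
`S₁ = {d ∈ A₁ : dᶜ ∈ B₀}` and `b` one supported on `S₂ ∪ S₃`, `S₂ = {d ∈ B₁ : dᶜ ∈ A₀}`, `S₃ = {d : dᶜ ∈ (A₁ \ A₀) ∩ (B₁ \ B₀)}`.  If
`Σ_d a_d [d ⊆ t] + Σ_d b_d [d ⊆ t] = 0` for all `t ∈ A₁ ∩ B₁` and `Σ_d b_d [d ⊆ t] = 0` for all `t ∈ A₀ ∩ B₀`, then `a = 0` and `b = 0`.
(The rows of the two-level inclusion matrix demands × supplies are linearly independent.) [this work] -/
theorem rankZ_kernel_eq_zero (A₀ A₁ B₀ B₁ : Finset (Finset α))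
    (hA₀ : IsUpperSet (A₀ : Set (Finset α))) (hA₁ : IsUpperSet (A₁ : Set (Finset α)))
    (hB₀ : IsUpperSet (B₀ : Set (Finset α))) (hB₁ : IsUpperSet (B₁ : Set (Finset α))) (hA : A₀ ⊆ A₁) (hB : B₀ ⊆ B₁)
    (a b : Finset α → ℚ)
    (ha : ∀ d, a d ≠ 0 → d ∈ A₁ ∧ dᶜ ∈ B₀)
    (hb : ∀ d, b d ≠ 0 → (dᶜ ∈ A₀ ∧ d ∈ B₁) ∨ (dᶜ ∈ A₁ ∧ dᶜ ∉ A₀ ∧ dᶜ ∈ B₁ ∧ dᶜ ∉ B₀))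
    (h1 : ∀ t, t ∈ A₁ → t ∈ B₁ →
      ∑ d, a d * (if d ⊆ t then (1 : ℚ) else 0) + ∑ d, b d * (if d ⊆ t then (1 : ℚ) else 0) = 0)
    (h2 : ∀ t, t ∈ A₀ → t ∈ B₀ → ∑ d, b d * (if d ⊆ t then (1 : ℚ) else 0) = 0) :
    (∀ d, a d = 0) ∧ (∀ d, b d = 0) := by
  -- the big up-set `W = U₁ = A₁ ∩ B₁` and the small one `W₂ = U₂ = A₀ ∩ B₀`
  have hW : IsUpperSet ((A₁ ∩ B₁ : Finset (Finset α)) : Set (Finset α)) := by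
    rw [coe_inter]; exact hA₁.inter hB₁
  have hW₂ : IsUpperSet ((A₀ ∩ B₀ : Finset (Finset α)) : Set (Finset α)) := by
    rw [coe_inter]; exact hA₀.inter hB₀
  -- antipodal-basis coordinates of every zeta function on `W` (support lemma)
  choose c hcδ hcsupp hcid using fun d => exists_support_coef hW d
  -- the transfer identity: a combination of zeta functions, re-expanded in the coordinates, has the same values on `W`
  have transfer : ∀ (x : Finset α → ℚ), ∀ t ∈ A₁ ∩ B₁,
      ∑ e, (∑ d, x d * c d e) * (if e ⊆ t then (1 : ℚ) else 0) = ∑ d, x d * (if d ⊆ t then (1 : ℚ) else 0) := by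
    intro x t ht
    calc ∑ e, (∑ d, x d * c d e) * (if e ⊆ t then (1 : ℚ) else 0)
        = ∑ e, ∑ d, x d * (c d e * (if e ⊆ t then (1 : ℚ) else 0)) := by
          refine sum_congr rfl fun e _ => ?_
          rw [Finset.sum_mul]
          refine sum_congr rfl fun d _ => ?_
          ring
      _ = ∑ d, ∑ e, x d * (c d e * (if e ⊆ t then (1 : ℚ) else 0)) := Finset.sum_comm
      _ = ∑ d, x d * ∑ e, c d e * (if e ⊆ t then (1 : ℚ) else 0) := by
          refine sum_congr rfl fun d _ => ?_
          rw [Finset.mul_sum]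
      _ = ∑ d, x d * (if d ⊆ t then (1 : ℚ) else 0) := by
          refine sum_congr rfl fun d _ => ?_
          rw [← hcid d t ht]
  -- split `b = b₂ + b₃` along `S₂ ⊔ S₃`
  obtain ⟨b₂, hb₂⟩ : ∃ f : Finset α → ℚ, ∀ d, f d = if dᶜ ∈ A₀ then b d else 0 := ⟨_, fun _ => rfl⟩
  obtain ⟨b₃, hb₃⟩ : ∃ f : Finset α → ℚ, ∀ d, f d = if dᶜ ∈ A₀ then 0 else b d := ⟨_, fun _ => rfl⟩
  have hbsplit : ∀ d, b d = b₂ d + b₃ d := by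
    intro d; rw [hb₂ d, hb₃ d]; split_ifs <;> simp
  have hb₂supp : ∀ d, b₂ d ≠ 0 → dᶜ ∈ A₀ ∧ d ∈ B₁ := by
    intro d hd
    rw [hb₂ d] at hd
    by_cases h : dᶜ ∈ A₀
    · rw [if_pos h] at hd
      rcases hb d hd with h' | h'
      · exact ⟨h, h'.2⟩
      · exact absurd h h'.2.1
    · rw [if_neg h] at hd
      exact absurd rfl hd
  have hb₃supp : ∀ d, b₃ d ≠ 0 → dᶜ ∈ A₁ ∧ dᶜ ∉ A₀ ∧ dᶜ ∈ B₁ ∧ dᶜ ∉ B₀ := by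
    intro d hd
    rw [hb₃ d] at hd
    by_cases h : dᶜ ∈ A₀
    · rw [if_pos h] at hd
      exact absurd rfl hd
    · rw [if_neg h] at hd
      rcases hb d hd with h' | h'
      · exact absurd h'.1 h
      · exact h'
  -- coordinate vectors of the three parts
  obtain ⟨Aco, hAco⟩ : ∃ f : Finset α → ℚ, ∀ e, f e = ∑ d, a d * c d e := ⟨_, fun _ => rfl⟩
  obtain ⟨Bco, hBco⟩ : ∃ f : Finset α → ℚ, ∀ e, f e = ∑ d, b₂ d * c d e := ⟨_, fun _ => rfl⟩
  -- the `S₃`-part is its own coordinate vector (its sets have complements in `W`)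
  have hB3co : ∀ e, ∑ d, b₃ d * c d e = b₃ e := by
    intro e
    have hterm : ∀ d, b₃ d * c d e = if e = d then b₃ e else 0 := by
      intro d
      by_cases h0 : b₃ d = 0
      · rw [h0, zero_mul]
        split_ifs with hed
        · rw [hed, h0]
        · rfl
      · have hdW : dᶜ ∈ A₁ ∩ B₁ := by
          obtain ⟨h1', -, h3', -⟩ := hb₃supp d h0
          exact mem_inter.2 ⟨h1', h3'⟩
        rw [hcδ d hdW]
        dsimp only
        split_ifs with hed
        · rw [hed, mul_one]
        · rw [mul_zero]
    rw [Finset.sum_congr rfl fun d _ => hterm d, Finset.sum_ite_eq]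
    simp
  -- supports of the coordinate vectors
  have hAsupp : ∀ e, Aco e ≠ 0 → eᶜ ∈ A₁ ∩ B₁ ∧ eᶜ ∈ B₀ := by
    intro e he
    rw [hAco e] at he
    obtain ⟨d, -, hd⟩ := Finset.exists_ne_zero_of_sum_ne_zero he
    have had : a d ≠ 0 := left_ne_zero_of_mul hd
    obtain ⟨heW, hed⟩ := hcsupp d e (right_ne_zero_of_mul hd)
    exact ⟨heW, hB₀ (Finset.compl_subset_compl.2 hed) (ha d had).2⟩
  have hBsupp : ∀ e, Bco e ≠ 0 → eᶜ ∈ A₁ ∩ B₁ ∧ eᶜ ∈ A₀ := by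
    intro e he
    rw [hBco e] at he
    obtain ⟨d, -, hd⟩ := Finset.exists_ne_zero_of_sum_ne_zero he
    have hbd : b₂ d ≠ 0 := left_ne_zero_of_mul hd
    obtain ⟨heW, hed⟩ := hcsupp d e (right_ne_zero_of_mul hd)
    exact ⟨heW, hA₀ (Finset.compl_subset_compl.2 hed) (hb₂supp d hbd).1⟩
  -- STEP (b): the first equation, read in antipodal coordinates on `W`, says `Aco + Bco + b₃ = 0`
  have hrel : ∀ t ∈ A₁ ∩ B₁, ∑ e, (Aco e + Bco e + b₃ e) * (if e ⊆ t then (1 : ℚ) else 0) = 0 := by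
    intro t ht
    have hsplit : ∑ e, (Aco e + Bco e + b₃ e) * (if e ⊆ t then (1 : ℚ) else 0)
        = ∑ d, a d * (if d ⊆ t then (1 : ℚ) else 0) + ∑ d, b d * (if d ⊆ t then (1 : ℚ) else 0) := by
      have e3 : ∀ e, Aco e + Bco e + b₃ e = (∑ d, a d * c d e) + (∑ d, b₂ d * c d e) + (∑ d, b₃ d * c d e) := by
        intro e; rw [hAco e, hBco e, hB3co e]
      simp only [e3, add_mul, Finset.sum_add_distrib]
      rw [transfer a t ht, transfer b₂ t ht, transfer b₃ t ht, add_assoc, ← Finset.sum_add_distrib]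
      congr 1
      refine sum_congr rfl fun d _ => ?_
      rw [hbsplit d]; ring
    rw [hsplit]
    exact h1 t (mem_inter.1 ht).1 (mem_inter.1 ht).2
  have hsum0 : ∀ e, Aco e + Bco e + b₃ e = 0 := by
    refine eq_zero_of_zeta_sum_eq_zero hW (fun e => Aco e + Bco e + b₃ e) ?_ hrel
    intro e he
    by_contra hW'
    have h1' : Aco e = 0 := by by_contra h; exact hW' (hAsupp e h).1
    have h2' : Bco e = 0 := by by_contra h; exact hW' (hBsupp e h).1
    have h3' : b₃ e = 0 := by
      by_contra h
      obtain ⟨x1, -, x3, -⟩ := hb₃supp e h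
      exact hW' (mem_inter.2 ⟨x1, x3⟩)
    apply he
    rw [h1', h2', h3']; ring
  -- `b₃ = 0`: at an `S₃`-index the other two coordinate vectors vanish
  have hb₃zero : ∀ e, b₃ e = 0 := by
    intro e
    by_contra hne
    obtain ⟨-, hnA₀, -, hnB₀⟩ := hb₃supp e hne
    have h1' : Aco e = 0 := by by_contra h; exact hnB₀ (hAsupp e h).2
    have h2' : Bco e = 0 := by by_contra h; exact hnA₀ (hBsupp e h).2
    have h := hsum0 e
    rw [h1', h2', zero_add, zero_add] at h
    exact hne h
  -- `Aco = -Bco`, so `Aco` is supported on `refl (A₀ ∩ B₀)`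
  have hAB : ∀ e, Aco e + Bco e = 0 := by
    intro e; have h := hsum0 e; rwa [hb₃zero e, add_zero] at h
  have hAsupp2 : ∀ e, Aco e ≠ 0 → eᶜ ∈ A₀ ∩ B₀ := by
    intro e he
    have hB : Bco e ≠ 0 := by
      intro h; apply he; have h' := hAB e; rwa [h, add_zero] at h'
    exact mem_inter.2 ⟨(hBsupp e hB).2, (hAsupp e he).2⟩
  -- STEP (c): on `U₂ = A₀ ∩ B₀` the `S₁`-part vanishes (first minus second equation); C1 on `U₂` kills `Aco`
  have hAzero : ∀ e, Aco e = 0 := by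
    refine eq_zero_of_zeta_sum_eq_zero hW₂ Aco hAsupp2 ?_
    intro t ht
    have htA₀ : t ∈ A₀ := (mem_inter.1 ht).1
    have htB₀ : t ∈ B₀ := (mem_inter.1 ht).2
    have htW : t ∈ A₁ ∩ B₁ := mem_inter.2 ⟨hA htA₀, hB htB₀⟩
    rw [Finset.sum_congr rfl fun e _ => by rw [hAco e], transfer a t htW]
    have e1 := h1 t (hA htA₀) (hB htB₀)
    rwa [h2 t htA₀ htB₀, add_zero] at e1
  -- STEP (d): the `S₁`-combination vanishes on `W`, hence on all of `B₀`; C1 on `B₀` gives `a = 0`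
  have hazero : ∀ d, a d = 0 := by
    refine eq_zero_of_zeta_sum_eq_zero hB₀ a (fun d hd => (ha d hd).2) ?_
    intro t htB₀
    by_cases htA₁ : t ∈ A₁
    · have htW : t ∈ A₁ ∩ B₁ := mem_inter.2 ⟨htA₁, hB htB₀⟩
      rw [← transfer a t htW]
      refine Finset.sum_eq_zero fun e _ => ?_
      rw [← hAco e, hAzero e, zero_mul]
    · refine Finset.sum_eq_zero fun d _ => ?_
      by_cases hd : a d = 0
      · rw [hd, zero_mul]
      · have hdt : ¬ d ⊆ t := fun h => htA₁ (hA₁ h (ha d hd).1)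
        rw [if_neg hdt, mul_zero]
  -- and symmetrically `Bco = 0`, so the `S₂`-combination vanishes on `W`, hence on `A₀`; C1 on `A₀` gives `b₂ = 0`
  have hBzero : ∀ e, Bco e = 0 := by
    intro e; have h := hAB e; rwa [hAzero e, zero_add] at h
  have hb₂zero : ∀ d, b₂ d = 0 := by
    refine eq_zero_of_zeta_sum_eq_zero hA₀ b₂ (fun d hd => (hb₂supp d hd).1) ?_
    intro t htA₀
    by_cases htB₁ : t ∈ B₁
    · have htW : t ∈ A₁ ∩ B₁ := mem_inter.2 ⟨hA htA₀, htB₁⟩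
      rw [← transfer b₂ t htW]
      refine Finset.sum_eq_zero fun e _ => ?_
      rw [← hBco e, hBzero e, zero_mul]
    · refine Finset.sum_eq_zero fun d _ => ?_
      by_cases hd : b₂ d = 0
      · rw [hd, zero_mul]
      · have hdt : ¬ d ⊆ t := fun h => htB₁ (hB₁ h (hb₂supp d hd).2)
        rw [if_neg hdt, mul_zero]
  exact ⟨hazero, fun d => by rw [hbsplit d, hb₂zero d, hb₃zero d, add_zero]⟩

/-- **(RANK-Z), kernel form for a general up-set `P`** (memo §1: the restriction to `P` is free).  Same as `rankZ_kernel_eq_zero` with the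
supports of `a`, `b` inside `P` and the two equations required only at `t ∈ P`: at `t ∉ P` every term `[d ⊆ t]` with `d ∈ P` vanishes because
`P` is an up-set. [this work] -/
theorem rankZ_kernel_eq_zero_of_upperSet (P A₀ A₁ B₀ B₁ : Finset (Finset α)) (hP : IsUpperSet (P : Set (Finset α)))
    (hA₀ : IsUpperSet (A₀ : Set (Finset α))) (hA₁ : IsUpperSet (A₁ : Set (Finset α)))
    (hB₀ : IsUpperSet (B₀ : Set (Finset α))) (hB₁ : IsUpperSet (B₁ : Set (Finset α))) (hA : A₀ ⊆ A₁) (hB : B₀ ⊆ B₁)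
    (a b : Finset α → ℚ)
    (ha : ∀ d, a d ≠ 0 → d ∈ P ∧ d ∈ A₁ ∧ dᶜ ∈ B₀)
    (hb : ∀ d, b d ≠ 0 → d ∈ P ∧ ((dᶜ ∈ A₀ ∧ d ∈ B₁) ∨ (dᶜ ∈ A₁ ∧ dᶜ ∉ A₀ ∧ dᶜ ∈ B₁ ∧ dᶜ ∉ B₀)))
    (h1 : ∀ t, t ∈ P → t ∈ A₁ → t ∈ B₁ →
      ∑ d, a d * (if d ⊆ t then (1 : ℚ) else 0) + ∑ d, b d * (if d ⊆ t then (1 : ℚ) else 0) = 0)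
    (h2 : ∀ t, t ∈ P → t ∈ A₀ → t ∈ B₀ → ∑ d, b d * (if d ⊆ t then (1 : ℚ) else 0) = 0) :
    (∀ d, a d = 0) ∧ (∀ d, b d = 0) := by
  have vanish : ∀ (x : Finset α → ℚ), (∀ d, x d ≠ 0 → d ∈ P) → ∀ t, t ∉ P →
      ∑ d, x d * (if d ⊆ t then (1 : ℚ) else 0) = 0 := by
    intro x hx t ht
    refine Finset.sum_eq_zero fun d _ => ?_
    by_cases hd : x d = 0
    · rw [hd, zero_mul]
    · have hdt : ¬ d ⊆ t := fun h => ht (hP h (hx d hd))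
      rw [if_neg hdt, mul_zero]
  refine rankZ_kernel_eq_zero A₀ A₁ B₀ B₁ hA₀ hA₁ hB₀ hB₁ hA hB a b (fun d hd => (ha d hd).2) (fun d hd => (hb d hd).2) ?_ ?_
  · intro t htA₁ htB₁
    by_cases htP : t ∈ P
    · exact h1 t htP htA₁ htB₁
    · rw [vanish a (fun d hd => (ha d hd).1) t htP, vanish b (fun d hd => (hb d hd).1) t htP, add_zero]
  · intro t htA₀ htB₀
    by_cases htP : t ∈ P
    · exact h2 t htP htA₀ htB₀
    · exact vanish b (fun d hd => (hb d hd).1) t htP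

/-! ### The theorem -/

/-- **THE FIVE-UP-SET INEQUALITY** (`FiveUpSet.FiveUpSetIneq`, conjectured in `…SahiCombFiveUpSet`, report §11.3) **HOLDS**: for up-sets
`P, A₀ ⊆ A₁, B₀ ⊆ B₁` of a finite cube,
`#(P ∩ A₁ ∩ refl B₀) + #(P ∩ refl A₀ ∩ B₁) + #(P ∩ refl (A₁ \ A₀) ∩ refl (B₁ \ B₀)) ≤ #(P ∩ A₁ ∩ B₁) + #(P ∩ A₀ ∩ B₀)`.
PROOF (RANK-Z): index the left side by the demand type `D₁ ⊕ (D₂ ∪ D₃)` and the right side by the supply type `T₁ ⊕ T₂`; the demand vectors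
`(d,1) ↦ ([d ⊆ t] on T₁, 0 on T₂)`, `(d,0) ↦ ([d ⊆ t] on T₁, [d ⊆ t] on T₂)` are linearly independent in `ℚ^{T₁ ⊕ T₂}` by
`rankZ_kernel_eq_zero_of_upperSet`, so their number is at most the dimension. [this work] -/
theorem fiveUpSetIneq_holds : FiveUpSetIneq := by
  intro α _ _ P A₀ A₁ B₀ B₁ hP hA₀ hA₁ hB₀ hB₁ hA hB
  -- `D₂` and `D₃` are disjoint
  have hD23 : Disjoint (P ∩ refl A₀ ∩ B₁) (P ∩ refl (A₁ \ A₀) ∩ refl (B₁ \ B₀)) := by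
    rw [disjoint_left]
    intro d hd2 hd3
    have h2 : dᶜ ∈ A₀ := mem_refl.1 (mem_inter.1 (mem_inter.1 hd2).1).2
    have h3 : dᶜ ∈ A₁ \ A₀ := mem_refl.1 (mem_inter.1 (mem_inter.1 hd3).1).2
    exact (mem_sdiff.1 h3).2 h2
  -- the demand vectors
  have hli : LinearIndependent ℚ
      (Sum.elim
        (fun d : ↥(P ∩ A₁ ∩ refl B₀) =>
          Sum.elim (fun t : ↥(P ∩ A₁ ∩ B₁) => if (d : Finset α) ⊆ (t : Finset α) then (1 : ℚ) else 0)
            (fun _ : ↥(P ∩ A₀ ∩ B₀) => (0 : ℚ)))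
        (fun d : ↥(P ∩ refl A₀ ∩ B₁ ∪ P ∩ refl (A₁ \ A₀) ∩ refl (B₁ \ B₀)) =>
          Sum.elim (fun t : ↥(P ∩ A₁ ∩ B₁) => if (d : Finset α) ⊆ (t : Finset α) then (1 : ℚ) else 0)
            (fun t : ↥(P ∩ A₀ ∩ B₀) => if (d : Finset α) ⊆ (t : Finset α) then (1 : ℚ) else 0))) := by
    rw [Fintype.linearIndependent_iff]
    intro g hg
    -- the two coefficient vectors on the cube
    obtain ⟨a, ha⟩ : ∃ f : Finset α → ℚ, ∀ d, f d = if h : d ∈ P ∩ A₁ ∩ refl B₀ then g (Sum.inl ⟨d, h⟩) else 0 :=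
      ⟨_, fun _ => rfl⟩
    obtain ⟨b, hb⟩ : ∃ f : Finset α → ℚ, ∀ d,
        f d = if h : d ∈ P ∩ refl A₀ ∩ B₁ ∪ P ∩ refl (A₁ \ A₀) ∩ refl (B₁ \ B₀) then g (Sum.inr ⟨d, h⟩) else 0 :=
      ⟨_, fun _ => rfl⟩
    have hasupp : ∀ d, a d ≠ 0 → d ∈ P ∩ A₁ ∩ refl B₀ := by
      intro d hd; by_contra h; rw [ha d, dif_neg h] at hd; exact hd rfl
    have hbsupp : ∀ d, b d ≠ 0 → d ∈ P ∩ refl A₀ ∩ B₁ ∪ P ∩ refl (A₁ \ A₀) ∩ refl (B₁ \ B₀) := by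
      intro d hd; by_contra h; rw [hb d, dif_neg h] at hd; exact hd rfl
    -- the sums over the index finsets are the sums over the cube
    have suma : ∀ t : Finset α, ∑ d : ↥(P ∩ A₁ ∩ refl B₀), g (Sum.inl d) * (if (d : Finset α) ⊆ t then (1 : ℚ) else 0)
        = ∑ d, a d * (if d ⊆ t then (1 : ℚ) else 0) := by
      intro t
      have h1 : ∑ d, a d * (if d ⊆ t then (1 : ℚ) else 0)
          = ∑ d ∈ P ∩ A₁ ∩ refl B₀, a d * (if d ⊆ t then (1 : ℚ) else 0) := by
        refine (Finset.sum_subset (subset_univ _) ?_).symm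
        intro d _ hd
        rw [ha d, dif_neg hd, zero_mul]
      rw [h1]
      conv_rhs => rw [← Finset.sum_coe_sort]
      refine Finset.sum_congr rfl fun d _ => ?_
      rw [ha d, dif_pos d.2]
    have sumb : ∀ t : Finset α,
        ∑ d : ↥(P ∩ refl A₀ ∩ B₁ ∪ P ∩ refl (A₁ \ A₀) ∩ refl (B₁ \ B₀)), g (Sum.inr d) * (if (d : Finset α) ⊆ t then (1 : ℚ) else 0)
        = ∑ d, b d * (if d ⊆ t then (1 : ℚ) else 0) := by
      intro t
      have h1 : ∑ d, b d * (if d ⊆ t then (1 : ℚ) else 0)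
          = ∑ d ∈ P ∩ refl A₀ ∩ B₁ ∪ P ∩ refl (A₁ \ A₀) ∩ refl (B₁ \ B₀), b d * (if d ⊆ t then (1 : ℚ) else 0) := by
        refine (Finset.sum_subset (subset_univ _) ?_).symm
        intro d _ hd
        rw [hb d, dif_neg hd, zero_mul]
      rw [h1]
      conv_rhs => rw [← Finset.sum_coe_sort]
      refine Finset.sum_congr rfl fun d _ => ?_
      rw [hb d, dif_pos d.2]
    -- the two equations
    have E1 : ∀ t, t ∈ P → t ∈ A₁ → t ∈ B₁ →
        ∑ d, a d * (if d ⊆ t then (1 : ℚ) else 0) + ∑ d, b d * (if d ⊆ t then (1 : ℚ) else 0) = 0 := by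
      intro t htP htA htB
      have h := congrFun hg (Sum.inl ⟨t, mem_inter.2 ⟨mem_inter.2 ⟨htP, htA⟩, htB⟩⟩)
      rw [Finset.sum_apply, Fintype.sum_sum_type] at h
      simp only [Pi.smul_apply, smul_eq_mul, Pi.zero_apply, Sum.elim_inl, Sum.elim_inr] at h
      rw [suma t, sumb t] at h
      exact h
    have E2 : ∀ t, t ∈ P → t ∈ A₀ → t ∈ B₀ → ∑ d, b d * (if d ⊆ t then (1 : ℚ) else 0) = 0 := by
      intro t htP htA htB
      have h := congrFun hg (Sum.inr ⟨t, mem_inter.2 ⟨mem_inter.2 ⟨htP, htA⟩, htB⟩⟩)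
      rw [Finset.sum_apply, Fintype.sum_sum_type] at h
      simp only [Pi.smul_apply, smul_eq_mul, Pi.zero_apply, Sum.elim_inl, Sum.elim_inr, mul_zero,
        Finset.sum_const_zero, zero_add] at h
      rw [sumb t] at h
      exact h
    -- the kernel theorem
    have K := rankZ_kernel_eq_zero_of_upperSet P A₀ A₁ B₀ B₁ hP hA₀ hA₁ hB₀ hB₁ hA hB a b ?_ ?_ E1 E2
    · rintro (⟨d, hd⟩ | ⟨d, hd⟩)
      · have h := K.1 d
        rwa [ha d, dif_pos hd] at h
      · have h := K.2 d
        rwa [hb d, dif_pos hd] at h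
    · intro d hd
      have h := hasupp d hd
      exact ⟨(mem_inter.1 (mem_inter.1 h).1).1, (mem_inter.1 (mem_inter.1 h).1).2, mem_refl.1 (mem_inter.1 h).2⟩
    · intro d hd
      have h := hbsupp d hd
      rcases mem_union.1 h with h | h
      · exact ⟨(mem_inter.1 (mem_inter.1 h).1).1,
          Or.inl ⟨mem_refl.1 (mem_inter.1 (mem_inter.1 h).1).2, (mem_inter.1 h).2⟩⟩
      · have h3 : dᶜ ∈ A₁ \ A₀ := mem_refl.1 (mem_inter.1 (mem_inter.1 h).1).2
        have h4 : dᶜ ∈ B₁ \ B₀ := mem_refl.1 (mem_inter.1 h).2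
        exact ⟨(mem_inter.1 (mem_inter.1 h).1).1,
          Or.inr ⟨(mem_sdiff.1 h3).1, (mem_sdiff.1 h3).2, (mem_sdiff.1 h4).1, (mem_sdiff.1 h4).2⟩⟩
  -- count: independent vectors are at most the dimension
  have hcard := hli.fintype_card_le_finrank
  rw [Module.finrank_fintype_fun_eq_card, Fintype.card_sum, Fintype.card_sum, Fintype.card_coe, Fintype.card_coe,
    Fintype.card_coe, Fintype.card_coe, card_union_of_disjoint hD23] at hcard
  omega

/-! ### Corollaries -/

/-- **The three-up-set inequality holds** (the face `B₀ = ∅` of the five-up-set inequality; `…SahiCombFiveUpSetHybrid`, prim-lf-1's `L0`,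
P5's (★3′)/(11★)): for up-sets `P`, `A₀ ⊆ A₁`, `B`, `#(P ∩ refl A₀ ∩ B) + #(P ∩ refl (A₁ \ A₀) ∩ refl B) ≤ #(P ∩ A₁ ∩ B)`. [this work] -/
theorem threeUpSetIneq_holds : ThreeUpSetIneq :=
  threeUpSet_of_fiveUpSet fiveUpSetIneq_holds

/-- **The hybrid Kleitman inequality holds** (`…SahiCombFiveUpSetHybrid`, report §12.4 (★3′)): for up-sets `U, X, B` and a down-set `D` of a
finite cube, `#(U ∩ refl X ∩ hybrid B D) ≤ #(U ∩ X ∩ B)` — Kleitman's antipodal lemma interpolated along an arbitrary cut `D`. [this work] -/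
theorem hybridKleitmanIneq_holds : HybridKleitmanIneq :=
  hybridKleitman_iff_threeUpSet.2 threeUpSetIneq_holds

end FiveUpSet

end Summit.CriticalPhenomena.PercolationContinuityZ3.Theorems
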